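import Mathlib
import Literature.Barriers.MatrixMultiplication.QuasirandomBarrierPowersAlternating
import Literature.RepresentationTheory.FiniteGroups.SymmetricGroupIsotypic
import Literature.RepresentationTheory.FiniteGroups.PermutationCharacter
import Summits.MatrixMultiplication.MatrixMultiplication.Theorems.SnSubsetDichotomyPolynomialSlackHookCharacters
import Summits.MatrixMultiplication.MatrixMultiplication.Theorems.SnSubsetDichotomyPolynomialSlackSpechtDimLower
import Summits.ValiantsHypothesis.ValiantsHypothesis.Theorems.MonotoneRestorationMixingScaleAlternatingMinimalDegree
import HarnessLib

/-!
# `PolynomialSlack` (stmt-MatrixMultiplication-8306): the second character degree of `S_n` is EXACTLY `n - 1`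

Helper for the PRINT REGIME of the crux `SnSubsetDichotomy.PolynomialSlack` (BCGPU 2023, Thm. 3.2 with
`n(S_n)`): the tree's `…PolynomialSlackMinDegree` proves only `⌊n/4⌋ ≤ n(S_n)` and records
`-- TODO(general form): the minimal degree is exactly n - 1 for n ≥ 5`.  This file settles it:

* `sub_one_le_of_mem_charDegrees_perm` — every irreducible degree `> 1` of `S_n` (`n ≥ 5`) is `≥ n - 1`;
* `secondCharDegree_perm_eq` — **`n(S_n) = secondCharDegree (Equiv.Perm (Fin n)) = n - 1` for `n ≥ 5`**;
* `sub_one_le_of_mem_charDegrees_alternatingGroup`, `secondCharDegree_alternatingGroup_eq` —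
  **`n(A_n) = n - 1` for `n ≥ 6`** (the "in fact" remark of BCGPU 2023 §5 left unproved in
  `Literature.Barriers.MatrixMultiplication.secondCharDegree_alternatingGroup_le`).

Proof: an irreducible character of `S_n` is a Specht character `χ^μ` (`irrChars_perm_eq`) of degree `f^μ`;
degree `> 1` excludes the row and the column (`χ^{(n)} = 1`, `χ^{(1ⁿ)} = sgn`), and then
`f^μ ≥ n - 1` is the linear Specht-dimension bound `SpechtDim.linear_le_syt` (filed with the discharge of
James–Kerber 2.5.15 under `Summits/ValiantsHypothesis/…/MonotoneRestorationMixingScaleSpechtDimLinear`).  For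
`A_n` the lower bound is the discharged fact `JamesKerber1981_thm_2_5_15_holds` (a representation of
dimension `> 1` which is irreducible is not trivial).  The upper bounds are the standard characters
`|fix| - 1` (J–L 29.11, tree `isIrrChar_perm_natCard_fixedBy_sub_one`, `secondCharDegree_alternatingGroup_le`).

References: R. Rasala, *On the minimal degrees of characters of `S_n`*, J. Algebra 45 (1977); G. James,
A. Kerber (1981), 2.4.10 and 2.5.15; BCGPU 2023, Def. 3.1 and §5.  Honest framing: a by-product on `n(G)`;
the crux `PolynomialSlack` and `ω` are untouched.
-/

noncomputable section

namespace Summit.MatrixMultiplication.MatrixMultiplication.Theorems.PolynomialSlack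

open Module Literature.RepresentationTheory.FiniteGroups Literature.NumberTheory.DiophantineGeometry
open Literature.Barriers.MatrixMultiplication
open Summit.ValiantsHypothesis.ValiantsHypothesis.Theorems.OrbitRestorationQPMixingScale

-- `Summit.<Summit>.<Problem>` is the tree's mandated summit-side namespace (CONVENTIONS §2); for
-- this single-conjunct summit the two coincide, so each declaration silences `dupNamespace`.
set_option linter.dupNamespace false

/-! ## `S_n` -/

/-- **Every irreducible character of `S_n` of degree `> 1` has degree `≥ n - 1`** (`n ≥ 5`; Rasala 1977 /
James–Kerber 2.4.10 — the sharp form of the tree's `div_four_le_of_mem_charDegrees_perm`). [folklore] -/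
theorem sub_one_le_of_mem_charDegrees_perm {n : ℕ} (hn : 5 ≤ n) {d : ℕ}
    (hd : d ∈ charDegrees (Equiv.Perm (Fin n))) (h1 : 1 < d) : n - 1 ≤ d := by
  obtain ⟨V, _, _, _, ρ, hρ, rfl⟩ := hd
  have hθ : ρ.character ∈ irrChars (Equiv.Perm (Fin n)) := ⟨V, _, _, ‹_›, ρ, hρ, rfl⟩
  obtain ⟨μ, hμ⟩ : ∃ μ : Nat.Partition n, spechtCharacter ℂ μ = ρ.character := by
    rw [irrChars_perm_eq] at hθ; exact hθ
  have hθ1 : ρ.character 1 = finrank ℂ V := ρ.char_one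
  have hf : spechtCharacter ℂ μ 1 = (numStandardTableaux μ : ℂ) := by
    show (spechtRep ℂ μ).character 1 = _
    rw [Representation.char_one, finrank_spechtIdeal_holds ℂ μ]
  rw [hμ, hθ1] at hf
  have hf' : numStandardTableaux μ = finrank ℂ V := by exact_mod_cast hf.symm
  have hYcard : μ.youngDiagram.cells.card = n := μ.card_cells_youngDiagram
  have hfY : numStandardTableaux μ = Nat.card (StdFilling μ.youngDiagram.cells.card μ.youngDiagram) :=
    numStandardTableaux_eq_card_stdFilling' μ
  -- not a row
  have hrow : μ.youngDiagram.rowLen 0 + 1 ≤ n := by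
    by_contra hlt
    have hle : μ.youngDiagram.rowLen 0 ≤ μ.youngDiagram.cells.card := by
      rw [YoungDiagram.rowLen_eq_card]
      exact Finset.card_le_card fun c hc => (YoungDiagram.mem_cells _).2 (YoungDiagram.mem_row_iff.1 hc).1
    have heq : μ.youngDiagram.rowLen 0 = n := by omega
    rcases rowLen_zero_mem_parts_or μ with hmemp | hz
    · rcases sortedParts_of_exists_large_part μ hmemp (by omega) with hs | hs
      · have h := spechtCharacter_of_sortedParts_eq_single μ hs 1
        rw [hμ, hθ1] at h
        have : finrank ℂ V = 1 := by exact_mod_cast h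
        omega
      · have hmem' : μ.youngDiagram.rowLen 0 ∈ μ.sortedParts := (Multiset.mem_sort _).2 hmemp
        rw [hs, heq] at hmem'
        simp only [List.mem_cons, List.not_mem_nil, or_false] at hmem'
        omega
    · omega
  -- not a column
  have hcol : μ.youngDiagram.colLen 0 + 1 ≤ n := by
    by_contra hlt
    rw [colLen_zero_youngDiagram] at hlt
    rcases sortedParts_of_card_parts_ge μ (by omega) with hs | hs
    · have h := spechtCharacter_of_sortedParts_eq_column μ (by omega) hs 1
      rw [hμ, hθ1, Equiv.Perm.sign_one, Units.val_one, Int.cast_one] at h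
      have : finrank ℂ V = 1 := by exact_mod_cast h
      omega
    · have hc : μ.parts.card = n - 1 := by
        rw [← μ.length_sortedParts, hs, List.length_cons, List.length_replicate]
        omega
      omega
  have key := SpechtDim.linear_le_syt (Y := μ.youngDiagram) (by omega) (by omega) (by omega)
  rw [← hfY, hf'] at key
  omega

/-- **`n(S_n) = n - 1` for `n ≥ 5`** (`secondCharDegree`, BCGPU 2023 Def. 3.1): the standard character
`|fix| - 1` has degree `n - 1 > 1`, and no smaller non-linear degree exists. [folklore] -/
theorem secondCharDegree_perm_eq {n : ℕ} (hn : 5 ≤ n) : secondCharDegree (Equiv.Perm (Fin n)) = n - 1 := by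
  haveI : Nontrivial (Fin n) := Fin.nontrivial_iff_two_le.mpr (by omega)
  have hχ := isIrrChar_perm_natCard_fixedBy_sub_one (Ω := Fin n)
  obtain ⟨d, hd, hχd⟩ := hχ.exists_apply_one
  have h1 : Nat.card (MulAction.fixedBy (Fin n) (1 : Equiv.Perm (Fin n))) = n := by
    rw [natCard_fixedBy_one, Nat.card_eq_fintype_card, Fintype.card_fin]
  have hdn : d = n - 1 := by
    have h' : ((n : ℂ)) - 1 = (d : ℂ) := by simpa [h1] using hχd
    have h'' : ((n - 1 : ℕ) : ℂ) = (d : ℂ) := by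
      rw [Nat.cast_sub (by omega : 1 ≤ n), Nat.cast_one]; exact h'
    exact (Nat.cast_injective h'').symm
  subst hdn
  refine le_antisymm (secondCharDegree_le hd (by omega)).2 ?_
  have hne : {d : ℕ | d ∈ charDegrees (Equiv.Perm (Fin n)) ∧ 1 < d}.Nonempty := ⟨n - 1, hd, by omega⟩
  have hmem := Nat.sInf_mem hne
  exact sub_one_le_of_mem_charDegrees_perm hn hmem.1 hmem.2

/-! ## `A_n` -/

/-- An irreducible representation of dimension `≥ 2` is not trivial: some group element acts
non-trivially (otherwise a line is a proper non-zero subrepresentation). [folklore] -/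
theorem exists_apply_ne_id_of_isIrreducible {G : Type} [Group G] {V : Type} [AddCommGroup V] [Module ℂ V]
    [FiniteDimensional ℂ V] (ρ : Representation ℂ G V) (hρ : ρ.IsIrreducible) (h2 : 2 ≤ finrank ℂ V) :
    ∃ g : G, ρ g ≠ LinearMap.id := by
  by_contra hall
  push Not at hall
  obtain ⟨v, hv⟩ : ∃ v : V, v ≠ 0 := by
    by_contra hno
    push Not at hno
    haveI : Subsingleton V := ⟨fun a b => by rw [hno a, hno b]⟩
    have := Module.finrank_zero_of_subsingleton (R := ℂ) (M := V)
    omega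
  let W : Subrepresentation ρ := ⟨Submodule.span ℂ {v}, fun g w hw => by rw [hall g]; exact hw⟩
  haveI := hρ
  rcases eq_bot_or_eq_top W with hW | hW
  · have hvW : v ∈ W.toSubmodule := Submodule.mem_span_singleton_self v
    have hbot : W.toSubmodule = ⊥ := by rw [hW]; rfl
    rw [hbot, Submodule.mem_bot] at hvW
    exact hv hvW
  · have htop : W.toSubmodule = ⊤ := by rw [hW]; rfl
    have hle : finrank ℂ (Submodule.span ℂ ({v} : Set V)) ≤ 1 :=
      (finrank_span_le_card ({v} : Set V)).trans (by simp)
    have : finrank ℂ (W.toSubmodule) = finrank ℂ V := by rw [htop, finrank_top]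
    change finrank ℂ (Submodule.span ℂ ({v} : Set V)) = _ at this
    omega

/-- **Every irreducible character of `A_n` of degree `> 1` has degree `≥ n - 1`** (`n ≥ 6`; James–Kerber
2.5.15, the tree's `JamesKerber1981_thm_2_5_15_holds`). [folklore] -/
theorem sub_one_le_of_mem_charDegrees_alternatingGroup {n : ℕ} (hn : 6 ≤ n) {d : ℕ}
    (hd : d ∈ charDegrees ↥(alternatingGroup (Fin n))) (h1 : 1 < d) : n - 1 ≤ d := by
  obtain ⟨V, _, _, _, ρ, hρ, rfl⟩ := hd
  exact AlternatingMinimalDegree.JamesKerber1981_thm_2_5_15_holds n (by omega) (by omega) (by omega) V ρ hρ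
    (exists_apply_ne_id_of_isIrreducible ρ hρ h1)

/-- **`n(A_n) = n - 1` for `n ≥ 6`** (BCGPU 2023 §5: "in fact `n(A_n) = n - 1`"; `n(A_5) = 3` is the
exception). [cite: BlasiakCohnGrochowPrattUmans2023, §5 (p. 12)] -/
theorem secondCharDegree_alternatingGroup_eq {n : ℕ} (hn : 6 ≤ n) :
    secondCharDegree ↥(alternatingGroup (Fin n)) = n - 1 := by
  obtain ⟨h2, hle⟩ := secondCharDegree_alternatingGroup_le (n := n) (by omega)
  refine le_antisymm hle ?_
  -- the infimum is attained (the set is non-empty since `2 ≤ n(A_n)` forces it)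
  have hne : {d : ℕ | d ∈ charDegrees ↥(alternatingGroup (Fin n)) ∧ 1 < d}.Nonempty := by
    by_contra hno
    rw [Set.not_nonempty_iff_eq_empty] at hno
    have : secondCharDegree ↥(alternatingGroup (Fin n)) = 0 := by
      rw [secondCharDegree, hno, Nat.sInf_empty]
    omega
  have hmem := Nat.sInf_mem hne
  exact sub_one_le_of_mem_charDegrees_alternatingGroup hn hmem.1 hmem.2

end Summit.MatrixMultiplication.MatrixMultiplication.Theorems.PolynomialSlack

end
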